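import Mathlib
import HarnessLib
import Summits.QuantumFields.YangMills.Theorems.MirrorModularBoostsHypercubicLimitTiltedMomentBounds
import Summits.QuantumFields.YangMills.Theorems.MirrorModularBoostsHypercubicLimitCouplingResponseDefs
import Summits.QuantumFields.YangMills.Theorems.MirrorModularBoostsHypercubicLimitTypedResponseNoGo
import Literature.MathematicalPhysics.QuantumLattice.SchwartzReIm
import Literature.MathematicalPhysics.QuantumFieldTheory.SpeciesLatticeProducts
import Literature.MathematicalPhysics.QuantumFieldTheory.LatticeGaugeProofs

/-!
# Stub `stub_derivToMoments` of line `Sketch` (coupling response): derivatives ⇒ moments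

File 4/4 (stmt-QuantumFields-16154, crux `HypercubicLimit`, registered skeleton `Cruxes/HypercubicLimit/Lines/Sketch.lean`,
reshape 2).  `ResponseDerivBounds r sch → UniformMomentBounds r sch`: `k`-uniform bounds `C₀ C₁ⁿ n!` on all real
derivatives at `0` of the order-one tilted responses of the renormalised curvature field, for all normalised disjointly
supported real pairs, give `k`-uniform bounds `Dⁿ n!` (`D = 2C₀ + 2e|C₁| + 1`) on the curvature's lattice `n`-point
functions on normalised, pairwise disjointly supported real product tensors — the abstract
`abs_integral_prod_le_of_tilted_deriv_bounds` (file 3/4) at each step `k`.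
-/

noncomputable section

open MeasureTheory Finset

namespace Summit.QuantumFields.YangMills.Cruxes.HypercubicLimit.CouplingResponse

/-! ## The registered stub: `ResponseDerivBounds r sch → UniformMomentBounds r sch` -/

section Stub

open Literature.MathematicalPhysics.QuantumLattice Literature.MathematicalPhysics.QuantumFieldTheory
open scoped SchwartzMap

/-- The Schwartz norms are subadditive over finite sums. [folklore] -/
theorem schwartzNorm_sum_le {X : Type*} [NormedAddCommGroup X] [NormedSpace ℝ X] (s : ℕ) {ι : Type*}
    (t : Finset ι) (F : ι → 𝓢(X, ℂ)) :
    schwartzNorm s (∑ i ∈ t, F i) ≤ ∑ i ∈ t, schwartzNorm s (F i) := by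
  classical
  induction t using Finset.induction_on with
  | empty =>
    simp only [sum_empty]
    exact le_of_eq (map_zero ((Finset.Iic (s, s)).sup (schwartzSeminormFamily ℂ X ℂ)))
  | insert a t ha ih =>
    rw [sum_insert ha, sum_insert ha]
    exact (map_add_le_add ((Finset.Iic (s, s)).sup (schwartzSeminormFamily ℂ X ℂ)) _ _).trans
      (add_le_add le_rfl ih)

/-- **Normalised sign combinations stay normalised**: if `|fᵢ|_s ≤ 1` for all `i`, then
`|(Σᵢ εᵢ fᵢ)/m|_s ≤ 1` (`schwartzNorm ∘ ofRealTest` is absolutely homogeneous and subadditive). [folklore] -/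
theorem schwartzNorm_signCombination_le {s m : ℕ} (v : Fin m → 𝓢(EuclideanSpace ℝ (Fin 4), ℝ))
    (ε : Fin m → Fin 2) (hv : ∀ i, schwartzNorm s (ofRealTest (v i)) ≤ 1) :
    schwartzNorm s (ofRealTest ((m : ℝ)⁻¹ • ∑ i, (-1 : ℝ) ^ (ε i : ℕ) • v i)) ≤ 1 := by
  rw [schwartzNorm_ofRealTest_smul, map_sum]
  have hle : schwartzNorm s (∑ i, ofRealTest ((-1 : ℝ) ^ (ε i : ℕ) • v i)) ≤ m := by
    refine (schwartzNorm_sum_le s _ _).trans ?_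
    calc ∑ i, schwartzNorm s (ofRealTest ((-1 : ℝ) ^ (ε i : ℕ) • v i)) ≤ ∑ _i : Fin m, (1 : ℝ) := by
          refine sum_le_sum fun i _ => ?_
          rw [schwartzNorm_ofRealTest_smul, abs_pow, abs_neg, abs_one, one_pow, one_mul]
          exact hv i
      _ = m := by simp
  rcases Nat.eq_zero_or_pos m with hm | hm
  · subst hm
    simp
  · have hmpos : (0 : ℝ) < m := by exact_mod_cast hm
    rw [abs_of_pos (inv_pos.2 hmpos)]
    calc (m : ℝ)⁻¹ * schwartzNorm s (∑ i, ofRealTest ((-1 : ℝ) ^ (ε i : ℕ) • v i)) ≤ (m : ℝ)⁻¹ * m :=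
          mul_le_mul_of_nonneg_left hle (inv_nonneg.2 hmpos.le)
      _ = 1 := inv_mul_cancel₀ hmpos.ne'

/-- **Disjointness from a support is stable under linear combinations** of Schwartz functions. [folklore] -/
theorem disjoint_tsupport_sum_smul {m : ℕ} (f₀ : 𝓢(EuclideanSpace ℝ (Fin 4), ℝ))
    (v : Fin m → 𝓢(EuclideanSpace ℝ (Fin 4), ℝ)) (c : Fin m → ℝ)
    (hd : ∀ i, Disjoint (tsupport ⇑f₀) (tsupport ⇑(v i))) :
    Disjoint (tsupport ⇑f₀) (tsupport ⇑(∑ i, c i • v i)) := by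
  classical
  suffices h : ∀ t : Finset (Fin m), Disjoint (tsupport ⇑f₀) (tsupport ⇑(∑ i ∈ t, c i • v i)) from h univ
  intro t
  induction t using Finset.induction_on with
  | empty =>
    rw [sum_empty, (tsupport_eq_empty_iff (f := ⇑(0 : 𝓢(EuclideanSpace ℝ (Fin 4), ℝ)))).2 rfl]
    exact Set.disjoint_empty _
  | insert a t ha ih =>
    rw [sum_insert ha]
    have hc : ⇑(c a • v a + ∑ i ∈ t, c i • v i) = ⇑(c a • v a) + ⇑(∑ i ∈ t, c i • v i) := rfl
    rw [hc]
    refine Disjoint.mono_right (tsupport_add _ _) (Disjoint.union_right ?_ ih)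
    exact (hd a).mono_right (tsupport_smul_schwartz_subset (c a) (v a))

/-- Additivity of the smeared lattice field in the test function. [folklore] -/
theorem smearedLatticeField_add {G : Type} [Group G] [MeasurableSpace G] (O : LGConfig 4 G → ℝ)
    (Λ : Finset (Literature.Probability.LatticeModels.Site 4)) (a c m : ℝ)
    (f g : 𝓢(EuclideanSpace ℝ (Fin 4), ℝ)) (U : LGConfig 4 G) :
    smearedLatticeField O Λ a c m (f + g) U =
      smearedLatticeField O Λ a c m f U + smearedLatticeField O Λ a c m g U := by
  unfold smearedLatticeField
  rw [← mul_add, ← Finset.sum_add_distrib]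
  congr 1
  refine Finset.sum_congr rfl fun x _ => ?_
  rw [show (f + g) (a • siteToE x) = f (a • siteToE x) + g (a • siteToE x) from rfl]
  ring

/-- **Stub `stub_derivToMoments` of line `Sketch` (reshape 2) — derivatives ⇒ moments.**  `k`-uniform bounds
`C₀ C₁ⁿ n!` on all real derivatives at `0` of the order-one tilted responses `t ↦ ∫ Φ_k(f₀) d(μ_k.tilted (t Φ_k(f₁)))`
for ALL normalised (`|·|_s ≤ 1`) disjointly supported real pairs imply `k`-uniform bounds `Dⁿ n!`,
`D = 2C₀ + 2e|C₁| + 1`, on the lattice `n`-point functions of the curvature on normalised, pairwise disjointly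
supported real product tensors: the abstract `abs_integral_prod_le_of_tilted_deriv_bounds` applied, at each `k`, to
the linear field `f ↦ Φ_k(f)` (bounded measurable observables under the step-`k` Wilson probability measure), the
admissible set `{|f|_s ≤ 1}` (closed under normalised sign combinations: `schwartzNorm_signCombination_le`) and the
disjoint-support relation (closed under linear combinations: `disjoint_tsupport_sum_smul`). [folklore] -/
theorem stub_derivToMoments :
    ∀ (G : Type) [Group G] [TopologicalSpace G] [IsTopologicalGroup G] [CompactSpace G] [MeasurableSpace G] [BorelSpace G] (r : LatticeRep G) (sch : SpeciesScheme (YMSpecies G)), ResponseDerivBounds r sch → UniformMomentBounds r sch := by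
  intro G _ _ _ _ _ _ r sch hRDB
  obtain ⟨s, C₀, C₁, h⟩ := hRDB
  -- `C₀ ≥ 0` (the bound at `n = 0` for the zero pair)
  have h00 : schwartzNorm s (ofRealTest (0 : 𝓢(EuclideanSpace ℝ (Fin 4), ℝ))) ≤ 1 := by
    rw [map_zero]
    exact (le_of_eq (map_zero ((Finset.Iic (s, s)).sup
      (schwartzSeminormFamily ℂ (EuclideanSpace ℝ (Fin 4)) ℂ)))).trans zero_le_one
  have hd00 : Disjoint (tsupport ⇑(0 : 𝓢(EuclideanSpace ℝ (Fin 4), ℝ)))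
      (tsupport ⇑(0 : 𝓢(EuclideanSpace ℝ (Fin 4), ℝ))) := by
    rw [(tsupport_eq_empty_iff (f := ⇑(0 : 𝓢(EuclideanSpace ℝ (Fin 4), ℝ)))).2 rfl]
    exact Set.disjoint_empty _
  have hC₀ : 0 ≤ C₀ := by
    have := h 0 0 h00 h00 hd00 0 0
    simp only [pow_zero, mul_one, Nat.factorial_zero, Nat.cast_one] at this
    exact (abs_nonneg _).trans this
  refine ⟨s, 1, 2 * C₀ + 2 * Real.exp 1 * |C₁| + 1, fun n f hf hdis k => ?_⟩
  rw [one_mul]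
  -- the step-`k` data
  haveI : IsProbabilityMeasure (wilsonAt r sch k) :=
    isProbabilityMeasure_wilsonMeasure (d := 4) (L := sch.side k) r.ρ r.continuous (sch.β k)
  let Φ : 𝓢(EuclideanSpace ℝ (Fin 4), ℝ) →ₗ[ℝ] (GaugeConfig 4 (sch.side k) G → ℝ) :=
    { toFun := fun g => curvField r sch k g
      map_add' := fun g g' => funext fun U => smearedLatticeField_add _ _ _ _ _ g g' _
      map_smul' := fun c g => funext fun U => smearedLatticeField_smul _ _ _ _ _ c g _ }
  have hΦ : ∀ g, IsBddMeas (Φ g) := fun g =>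
    ⟨measurable_smearedLatticeField_torusLift r.curvature _ _ _ _ g _,
      exists_bound_smearedLatticeField r.curvature.bounded _ _ _ _ g |>.imp fun C hC U => hC _⟩
  have hmain := abs_integral_prod_le_of_tilted_deriv_bounds (μ := wilsonAt r sch k) Φ hΦ
    {g | schwartzNorm s (ofRealTest g) ≤ 1} (fun g g' => Disjoint (tsupport ⇑g) (tsupport ⇑g'))
    (fun m v ε hv => schwartzNorm_signCombination_le v ε hv)
    (fun f₀ m v c hdv => disjoint_tsupport_sum_smul f₀ v c hdv) hC₀ (abs_nonneg C₁)
    (fun f₀ f₁ hf₀ hf₁ hdf m => (h f₀ f₁ hf₀ hf₁ hdf k m).trans (by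
      refine mul_le_mul_of_nonneg_right (mul_le_mul_of_nonneg_left ?_ hC₀) (Nat.cast_nonneg _)
      rw [pow_abs]
      exact le_abs_self _))
    n f hf hdis
  unfold latticeSchwinger
  exact hmain

end Stub

end Summit.QuantumFields.YangMills.Cruxes.HypercubicLimit.CouplingResponse

end
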